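import Literature.MathematicalPhysics.QuantumFieldTheory.ConformalBootstrap3D.BlockExchangeSymmetry
import Literature.MathematicalPhysics.QuantumFieldTheory.ConformalBootstrap3D.BlockReflectedCasimir
import Literature.MathematicalPhysics.QuantumFieldTheory.ConformalBootstrap3D.RadialConversion
import Mathlib.Analysis.Normed.Ring.InfiniteSum
import HarnessLib

/-!
# The exchange transform of a `z`-series block is again of `z`-series form on the half-bidisc

Step (C') of pub-ising3d RECIPE R20 (Dolan–Osborn 2011 eq. (2.23) as a theorem about the typed blocks).
For a double power series `K(z,z̄) = Σ k_{mn} z^m z̄^n` on the unit bidisc and a real exponent `γ`, the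
function

  `(1-y)^{-γ} (1-ȳ)^{-γ} · K(y/(y-1), ȳ/(ȳ-1))`

is, on the HALF-bidisc `|y|, |ȳ| < ½` (exactly where `|y/(y-1)| < 1`), the absolutely convergent double power
series with the explicit coefficients

  `exchCoeff γ k (M,N) = Σ_{m ≤ M, n ≤ N} e_{m}(M-m) e_{n}(N-n) (-1)^{m+n} k_{mn}`,
  `e_m(j) = (-1)^j C(-(m+γ), j) = [y^j](1-y)^{-(m+γ)}`

(`hasSum_exchCoeff`; proof: the four-index family `e_m(i)y^i · e_n(j)ȳ^j · (-1)^{m+n}k_{mn} y^m ȳ^n` is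
absolutely summable — fibrewise binomial series, then the majorant `Σ|k_{mn}|(|y|/(1-|y|))^m(|ȳ|/(1-|ȳ|))^n`,
finite iff `|y| < ½` — and is regrouped along the injective shift `((m,n),(i,j)) ↦ ((m+i,n+j),(i,j))`, the
pattern of `BlockConjugationSymmetry.IsDoublePowerSeriesOn.conj`). Rescaled to the unit bidisc
(`τ = 2y`): `isDoublePowerSeriesOn_exchHalf`. The array is symmetric when `k` is (`exchCoeff_symm`) and its
boundary row is `(-1)^ℓ` times the Dolan–Osborn one (`exchCoeff_fst_zero_of_lt`, `exchCoeff_ell_zero`) — the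
origin of the sign `(-1)^ℓ` in (2.23).

Applied to the typed block (`exchTransform_hrBlockAB_eq`): for `y, ȳ ∈ (0,½)`,
`exchTransform (Δ₃₄/2) (hrBlockAB (-Δ₁₂) Δ₃₄ Δ ℓ) (y,ȳ) = (yȳ)^α · exchSeries (α + Δ₃₄/2) k₂ K₂ (y,ȳ)` with
`α = (Δ-ℓ)/2`, `k₂ = hrMonomialCoeffAB (Δ₁₂/2) (Δ₃₄/2) Δ ℓ`, `K₂ = hrSeriesAB …` — the series form needed by the
coefficient extraction on `(0,½)²` (step (D'), not in this file).

References: F. A. Dolan, H. Osborn, arXiv:1108.6194, §2 eq. (2.23) [cite: DolanOsborn2011, §2 eq. (2.23)];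
F. A. Dolan, H. Osborn, Nucl. Phys. B 678 (2004) 491, §3 eqs. (3.10)–(3.11) [cite: DolanOsborn2004, §3 eqs. (3.10)–(3.11)].
-/

namespace Literature.MathematicalPhysics.QuantumFieldTheory.ConformalBootstrap3D

open Set Filter Topology Finset

/-! ### The binomial weights `e_m(j) = [y^j](1-y)^{-(m+γ)}` -/

/-- `e_m(j) = (-1)^j C(-(m+γ), j)`, the `j`-th Taylor coefficient of `(1-y)^{-(m+γ)}`. [folklore] -/
noncomputable def exchW (γ : ℝ) (m j : ℕ) : ℝ :=
  (-1) ^ j * Ring.choose (-((m : ℝ) + γ)) j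

/-- `e_m(0) = 1`. [folklore] -/
@[simp] theorem exchW_zero (γ : ℝ) (m : ℕ) : exchW γ m 0 = 1 := by
  rw [exchW, ring_choose_zero]; simp

/-- `Σ_j e_m(j) y^j = (1-y)^{-(m+γ)}` for `|y| < 1`. [folklore] -/
theorem hasSum_exchW (γ : ℝ) (m : ℕ) {y : ℝ} (hy : |y| < 1) :
    HasSum (fun j => exchW γ m j * y ^ j) ((1 - y) ^ (-((m : ℝ) + γ))) := by
  have hy' : |(-y)| < 1 := by rwa [abs_neg]
  have h := hasSum_ring_choose_mul_pow (-((m : ℝ) + γ)) hy'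
  rw [← sub_eq_add_neg] at h
  refine h.congr_fun fun j => ?_
  rw [exchW, neg_pow y j]
  ring

/-- `|e_m(j)| = |C(-(m+γ), j)|`. [folklore] -/
theorem abs_exchW (γ : ℝ) (m j : ℕ) : |exchW γ m j| = |Ring.choose (-((m : ℝ) + γ)) j| := by
  rw [exchW, abs_mul, abs_pow, abs_neg, abs_one, one_pow, one_mul]

/-- Absolute summability of the weight series for `|y| < 1`. [folklore] -/
theorem summable_abs_exchW (γ : ℝ) (m : ℕ) {y : ℝ} (hy : |y| < 1) :
    Summable (fun j => |exchW γ m j| * |y| ^ j) := by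
  have hy' : |(|y|)| < 1 := by rwa [abs_abs]
  refine (summable_abs_ring_choose_mul_pow (-((m : ℝ) + γ)) hy').congr fun j => ?_
  rw [abs_mul, abs_pow, abs_abs, abs_exchW]

/-- `x^{-(m+γ)} = x^{-γ} (x⁻¹)^m` for `x > 0`. [folklore] -/
theorem rpow_neg_natCast_add {x : ℝ} (hx : 0 < x) (γ : ℝ) (m : ℕ) :
    x ^ (-((m : ℝ) + γ)) = x ^ (-γ) * (x⁻¹) ^ m := by
  rw [show (-((m : ℝ) + γ)) = -γ + (-(m : ℝ)) by ring, Real.rpow_add hx, Real.rpow_neg hx.le (m : ℝ),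
    Real.rpow_natCast, inv_pow]

/-- Majorant of the weight series: `Σ_j |e_m(j)| t^j ≤ (1-t)^{-|γ|} ((1-t)⁻¹)^m` for `0 ≤ t < 1`. [folklore] -/
theorem tsum_abs_exchW_le (γ : ℝ) (m : ℕ) {t : ℝ} (ht0 : 0 ≤ t) (ht1 : t < 1) :
    ∑' j, |exchW γ m j| * t ^ j ≤ (1 - t) ^ (-|γ|) * ((1 - t)⁻¹) ^ m := by
  have h1 : ∑' j, |exchW γ m j| * t ^ j ≤ (1 - t) ^ (-|-((m : ℝ) + γ)|) := by
    have := tsum_abs_ring_choose_mul_pow_le (-((m : ℝ) + γ)) ht0 ht1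
    refine le_of_eq_of_le (tsum_congr fun j => by rw [abs_exchW]) this
  have h2 : (1 - t) ^ (-|-((m : ℝ) + γ)|) ≤ (1 - t) ^ (-((m : ℝ) + |γ|)) := by
    refine Real.rpow_le_rpow_of_exponent_ge (by linarith) (by linarith) ?_
    have : |-((m : ℝ) + γ)| ≤ (m : ℝ) + |γ| := by
      rw [abs_neg]
      calc |(m : ℝ) + γ| ≤ |(m : ℝ)| + |γ| := abs_add_le _ _
        _ = (m : ℝ) + |γ| := by rw [Nat.abs_cast]
    linarith
  have h3 : (1 - t) ^ (-((m : ℝ) + |γ|)) = (1 - t) ^ (-|γ|) * ((1 - t)⁻¹) ^ m :=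
    rpow_neg_natCast_add (by linarith) |γ| m
  exact (h1.trans h2).trans_eq h3

/-! ### The exchanged coefficient array -/

/-- **The coefficients of `(1-y)^{-γ}(1-ȳ)^{-γ} K(y/(y-1), ȳ/(ȳ-1))`**:
`exchCoeff γ k (M,N) = Σ_{m ≤ M} Σ_{n ≤ N} e_m(M-m) e_n(N-n) (-1)^{m+n} k_{mn}`. [folklore] -/
noncomputable def exchCoeff (γ : ℝ) (k : ℕ × ℕ → ℝ) (q : ℕ × ℕ) : ℝ :=
  ∑ m ∈ range (q.1 + 1), ∑ n ∈ range (q.2 + 1),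
    exchW γ m (q.1 - m) * exchW γ n (q.2 - n) * reflArr k (m, n)

/-- The exchanged function `(1-y)^{-γ}(1-ȳ)^{-γ} K(y/(y-1), ȳ/(ȳ-1))`. [folklore] -/
noncomputable def exchSeries (γ : ℝ) (K : ℝ → ℝ → ℝ) (y yb : ℝ) : ℝ :=
  (1 - y) ^ (-γ) * (1 - yb) ^ (-γ) * K (moebiusExch y) (moebiusExch yb)

section Series

variable {k : ℕ × ℕ → ℝ} {K : ℝ → ℝ → ℝ}

/-- The regrouping map `((m,n),(i,j)) ↦ ((m+i, n+j), (i,j))`. [folklore] -/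
def exchShift (x : (ℕ × ℕ) × (ℕ × ℕ)) : (ℕ × ℕ) × (ℕ × ℕ) :=
  ((x.1.1 + x.2.1, x.1.2 + x.2.2), x.2)

/-- `exchShift` is injective. [folklore] -/
theorem exchShift_injective : Function.Injective exchShift := by
  rintro ⟨⟨m, n⟩, ⟨i, j⟩⟩ ⟨⟨m', n'⟩, ⟨i', j'⟩⟩ hxy
  simp only [exchShift, Prod.mk.injEq] at hxy
  obtain ⟨⟨h1, h2⟩, h3, h4⟩ := hxy
  subst h3 h4
  have hm : m = m' := by omega
  have hn : n = n' := by omega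
  subst hm hn
  rfl

/-- The regrouped family: at `(q, (i,j))` with `i ≤ q₁`, `j ≤ q₂` the term
`e_{q₁-i}(i) e_{q₂-j}(j) k⁻_{q-(i,j)} y^{q₁} ȳ^{q₂}`, zero elsewhere. [folklore] -/
noncomputable def exchFamily (γ : ℝ) (k : ℕ × ℕ → ℝ) (y yb : ℝ) (w : (ℕ × ℕ) × (ℕ × ℕ)) : ℝ :=
  if w.2.1 ≤ w.1.1 ∧ w.2.2 ≤ w.1.2 then
    exchW γ (w.1.1 - w.2.1) w.2.1 * exchW γ (w.1.2 - w.2.2) w.2.2 *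
      reflArr k (w.1.1 - w.2.1, w.1.2 - w.2.2) * y ^ w.1.1 * yb ^ w.1.2
  else 0

/-- The plain four-index family `(e_m(i) y^i)(e_n(j) ȳ^j)(k⁻_{mn} y^m ȳ^n)`. [folklore] -/
noncomputable def exchProd (γ : ℝ) (k : ℕ × ℕ → ℝ) (y yb : ℝ) (x : (ℕ × ℕ) × (ℕ × ℕ)) : ℝ :=
  (exchW γ x.1.1 x.2.1 * y ^ x.2.1) * (exchW γ x.1.2 x.2.2 * yb ^ x.2.2) *
    (reflArr k x.1 * y ^ x.1.1 * yb ^ x.1.2)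

/-- Pulling the regrouped family back along `exchShift` gives the plain family. [folklore] -/
theorem exchFamily_exchShift (γ : ℝ) (k : ℕ × ℕ → ℝ) (y yb : ℝ) (x : (ℕ × ℕ) × (ℕ × ℕ)) :
    exchFamily γ k y yb (exchShift x) = exchProd γ k y yb x := by
  obtain ⟨⟨m, n⟩, ⟨i, j⟩⟩ := x
  simp only [exchFamily, exchShift, exchProd]
  rw [if_pos ⟨Nat.le_add_left _ _, Nat.le_add_left _ _⟩, Nat.add_sub_cancel, Nat.add_sub_cancel, pow_add,
    pow_add]
  ring

/-- Off the range of `exchShift` the regrouped family vanishes. [folklore] -/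
theorem exchFamily_eq_zero_of_not_mem_range (γ : ℝ) (k : ℕ × ℕ → ℝ) (y yb : ℝ)
    {w : (ℕ × ℕ) × (ℕ × ℕ)} (hw : w ∉ Set.range exchShift) : exchFamily γ k y yb w = 0 := by
  obtain ⟨⟨q₁, q₂⟩, ⟨i, j⟩⟩ := w
  simp only [exchFamily]
  split_ifs with hcond
  · exfalso
    apply hw
    refine ⟨((q₁ - i, q₂ - j), (i, j)), ?_⟩
    show ((q₁ - i + i, q₂ - j + j), (i, j)) = ((q₁, q₂), (i, j))
    rw [Nat.sub_add_cancel hcond.1, Nat.sub_add_cancel hcond.2]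
  · rfl

/-- The fibre of the regrouped family over `q` is supported in the box `[0,q₁] × [0,q₂]`. [folklore] -/
theorem exchFamily_eq_zero_of_not_mem_box (γ : ℝ) (k : ℕ × ℕ → ℝ) (y yb : ℝ) (q : ℕ × ℕ)
    {ij : ℕ × ℕ} (hij : ij ∉ range (q.1 + 1) ×ˢ range (q.2 + 1)) : exchFamily γ k y yb (q, ij) = 0 := by
  obtain ⟨q₁, q₂⟩ := q
  obtain ⟨i, j⟩ := ij
  simp only [exchFamily]
  rw [if_neg]
  intro hcond
  apply hij
  rw [Finset.mem_product, Finset.mem_range, Finset.mem_range]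
  exact ⟨by omega, by omega⟩

/-- The fibre sum over `q` is `exchCoeff γ k q · y^{q₁} ȳ^{q₂}` (reindex `m = q₁ - i`). [folklore] -/
theorem sum_box_exchFamily (γ : ℝ) (k : ℕ × ℕ → ℝ) (y yb : ℝ) (q : ℕ × ℕ) :
    ∑ ij ∈ range (q.1 + 1) ×ˢ range (q.2 + 1), exchFamily γ k y yb (q, ij) =
      exchCoeff γ k q * y ^ q.1 * yb ^ q.2 := by
  obtain ⟨q₁, q₂⟩ := q
  rw [exchCoeff, Finset.sum_mul, Finset.sum_mul, Finset.sum_product]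
  -- reindex the outer sum `i ↦ q₁ - i` and the inner sum `j ↦ q₂ - j`
  rw [← Finset.sum_range_reflect]
  refine Finset.sum_congr rfl fun i hi => ?_
  rw [Finset.sum_mul, Finset.sum_mul, ← Finset.sum_range_reflect]
  refine Finset.sum_congr rfl fun j hj => ?_
  rw [Finset.mem_range] at hi hj
  simp only [exchFamily]
  rw [if_pos ⟨by omega, by omega⟩]
  have e1 : q₁ - (q₁ + 1 - 1 - i) = i := by omega
  have e2 : q₂ - (q₂ + 1 - 1 - j) = j := by omega
  have e3 : q₁ + 1 - 1 - i = q₁ - i := by omega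
  have e4 : q₂ + 1 - 1 - j = q₂ - j := by omega
  rw [e3, e4] at *
  rw [show q₁ - (q₁ - i) = i by omega, show q₂ - (q₂ - j) = j by omega]

/-- `HasSum` over the fibre. [folklore] -/
theorem hasSum_fiber_exchFamily (γ : ℝ) (k : ℕ × ℕ → ℝ) (y yb : ℝ) (q : ℕ × ℕ) :
    HasSum (fun ij => exchFamily γ k y yb (q, ij)) (exchCoeff γ k q * y ^ q.1 * yb ^ q.2) := by
  rw [← sum_box_exchFamily]
  exact hasSum_sum_of_ne_finset_zero fun ij hij => exchFamily_eq_zero_of_not_mem_box γ k y yb q hij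

/-- `HasSum` of the absolute values over the fibre. [folklore] -/
theorem hasSum_fiber_abs_exchFamily (γ : ℝ) (k : ℕ × ℕ → ℝ) (y yb : ℝ) (q : ℕ × ℕ) :
    HasSum (fun ij => ‖exchFamily γ k y yb (q, ij)‖)
      (∑ ij ∈ range (q.1 + 1) ×ˢ range (q.2 + 1), ‖exchFamily γ k y yb (q, ij)‖) :=
  hasSum_sum_of_ne_finset_zero fun ij hij => by
    rw [exchFamily_eq_zero_of_not_mem_box γ k y yb q hij, norm_zero]

/-- The coefficient bound `|exchCoeff q| |y|^{q₁} |ȳ|^{q₂} ≤ Σ_{box} |exchFamily (q, ·)|`. [folklore] -/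
theorem abs_exchCoeff_mul_le (γ : ℝ) (k : ℕ × ℕ → ℝ) (y yb : ℝ) (q : ℕ × ℕ) :
    |exchCoeff γ k q| * |y| ^ q.1 * |yb| ^ q.2 ≤
      ∑ ij ∈ range (q.1 + 1) ×ˢ range (q.2 + 1), ‖exchFamily γ k y yb (q, ij)‖ := by
  calc |exchCoeff γ k q| * |y| ^ q.1 * |yb| ^ q.2
      = |exchCoeff γ k q * y ^ q.1 * yb ^ q.2| := by rw [abs_mul, abs_mul, abs_pow, abs_pow]
    _ = |∑ ij ∈ range (q.1 + 1) ×ˢ range (q.2 + 1), exchFamily γ k y yb (q, ij)| := by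
        rw [sum_box_exchFamily]
    _ ≤ ∑ ij ∈ range (q.1 + 1) ×ˢ range (q.2 + 1), |exchFamily γ k y yb (q, ij)| :=
        Finset.abs_sum_le_sum_abs _ _
    _ = _ := rfl

/-- `|y/(y-1)| < 1` iff `|y| < ½`; here the direction used. [folklore] -/
theorem abs_moebiusExch_lt_one {y : ℝ} (hy : |y| < 1 / 2) : |moebiusExch y| < 1 := by
  have hy1 : y < 1 / 2 := (abs_lt.mp hy).2
  have hy0 : -(1 / 2) < y := (abs_lt.mp hy).1
  have hne : 1 - y > 0 := by linarith
  rw [moebiusExch_def, show y / (y - 1) = -(y / (1 - y)) by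
    rw [← neg_div_neg_eq, neg_sub]; ring, abs_neg, abs_div, abs_of_pos hne, div_lt_one hne]
  rcases le_or_gt 0 y with h | h
  · rw [abs_of_nonneg h]; linarith
  · rw [abs_of_neg h]; linarith

/-- `y/(y-1) = -y·(1-y)⁻¹`. [folklore] -/
theorem moebiusExch_eq_neg_mul_inv (y : ℝ) : moebiusExch y = -y * (1 - y)⁻¹ := by
  rw [moebiusExch_def, div_eq_mul_inv, show y - 1 = -(1 - y) by ring, inv_neg]
  ring

/-- **The exchanged function is a double power series on the half-bidisc.** For `|y|, |ȳ| < ½`: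
`Σ_q exchCoeff γ k q y^{q₁} ȳ^{q₂} = (1-y)^{-γ}(1-ȳ)^{-γ} K(y/(y-1), ȳ/(ȳ-1))` and the series of absolute
values converges. [cite: DolanOsborn2011, §2 eq. (2.23)] -/
theorem hasSum_exchCoeff (hS : IsDoublePowerSeriesOn k K) (γ : ℝ) {y yb : ℝ} (hy : |y| < 1 / 2)
    (hyb : |yb| < 1 / 2) :
    HasSum (fun q : ℕ × ℕ => exchCoeff γ k q * y ^ q.1 * yb ^ q.2) (exchSeries γ K y yb) ∧
      Summable (fun q : ℕ × ℕ => |exchCoeff γ k q| * |y| ^ q.1 * |yb| ^ q.2) := by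
  have hy1 : |y| < 1 := hy.trans (by norm_num)
  have hyb1 : |yb| < 1 := hyb.trans (by norm_num)
  -- the majorant point `(u, ū) = (|y|/(1-|y|), |ȳ|/(1-|ȳ|)) ∈ [0,1)²`
  set t := |y| with ht
  set tb := |yb| with htb
  have ht0 : 0 ≤ t := abs_nonneg y
  have htb0 : 0 ≤ tb := abs_nonneg yb
  have ht1 : t < 1 / 2 := hy
  have htb1 : tb < 1 / 2 := hyb
  set u := t * (1 - t)⁻¹ with hu
  set ub := tb * (1 - tb)⁻¹ with hub
  have h1t : 0 < 1 - t := by linarith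
  have h1tb : 0 < 1 - tb := by linarith
  have hu0 : 0 ≤ u := mul_nonneg ht0 (inv_nonneg.mpr h1t.le)
  have hub0 : 0 ≤ ub := mul_nonneg htb0 (inv_nonneg.mpr h1tb.le)
  have hu1 : u < 1 := by
    rw [hu, ← div_eq_mul_inv, div_lt_one h1t]; linarith
  have hub1 : ub < 1 := by
    rw [hub, ← div_eq_mul_inv, div_lt_one h1tb]; linarith
  -- absolute summability of the four-index family, outer index `(m,n)`
  set F : (ℕ × ℕ) × (ℕ × ℕ) → ℝ := exchProd γ k y yb with hF
  have hFnn : 0 ≤ fun x => ‖F x‖ := fun x => norm_nonneg _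
  have hnormF : ∀ x : (ℕ × ℕ) × (ℕ × ℕ), ‖F x‖ =
      (|reflArr k x.1| * t ^ x.1.1 * tb ^ x.1.2) *
        ((|exchW γ x.1.1 x.2.1| * t ^ x.2.1) * (|exchW γ x.1.2 x.2.2| * tb ^ x.2.2)) := by
    intro x
    rw [hF, exchProd, Real.norm_eq_abs]
    simp only [abs_mul, abs_pow, ht, htb]
    ring
  have hinner : ∀ mn : ℕ × ℕ, Summable fun ij : ℕ × ℕ => ‖F (mn, ij)‖ := by
    intro mn
    have hs := ((summable_abs_exchW γ mn.1 hy1).mul_of_nonneg (summable_abs_exchW γ mn.2 hyb1)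
      (fun i => by positivity) (fun j => by positivity)).mul_left (|reflArr k mn| * t ^ mn.1 * tb ^ mn.2)
    refine hs.congr fun ij => ?_
    rw [hnormF]
  have hinner_le : ∀ mn : ℕ × ℕ, ∑' ij : ℕ × ℕ, ‖F (mn, ij)‖ ≤
      |k mn| * u ^ mn.1 * ub ^ mn.2 * ((1 - t) ^ (-|γ|) * (1 - tb) ^ (-|γ|)) := by
    intro mn
    have hA := tsum_abs_exchW_le γ mn.1 ht0 (by linarith)
    have hB := tsum_abs_exchW_le γ mn.2 htb0 (by linarith)
    have nA : Summable fun i => ‖|exchW γ mn.1 i| * t ^ i‖ :=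
      (summable_abs_exchW γ mn.1 hy1).norm
    have nB : Summable fun j => ‖|exchW γ mn.2 j| * tb ^ j‖ :=
      (summable_abs_exchW γ mn.2 hyb1).norm
    have hprod : ∑' ij : ℕ × ℕ, (|exchW γ mn.1 ij.1| * t ^ ij.1) * (|exchW γ mn.2 ij.2| * tb ^ ij.2) =
        (∑' i, |exchW γ mn.1 i| * t ^ i) * (∑' j, |exchW γ mn.2 j| * tb ^ j) :=
      (tsum_mul_tsum_of_summable_norm nA nB).symm
    have hk : |reflArr k mn| = |k mn| := by
      rw [reflArr, abs_mul, abs_pow, abs_neg, abs_one, one_pow, one_mul]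
    calc ∑' ij : ℕ × ℕ, ‖F (mn, ij)‖
        = ∑' ij : ℕ × ℕ, (|reflArr k mn| * t ^ mn.1 * tb ^ mn.2) *
            ((|exchW γ mn.1 ij.1| * t ^ ij.1) * (|exchW γ mn.2 ij.2| * tb ^ ij.2)) :=
          tsum_congr fun ij => hnormF (mn, ij)
      _ = (|reflArr k mn| * t ^ mn.1 * tb ^ mn.2) *
            ((∑' i, |exchW γ mn.1 i| * t ^ i) * (∑' j, |exchW γ mn.2 j| * tb ^ j)) := by
          rw [tsum_mul_left, hprod]
      _ ≤ (|reflArr k mn| * t ^ mn.1 * tb ^ mn.2) *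
            (((1 - t) ^ (-|γ|) * ((1 - t)⁻¹) ^ mn.1) * ((1 - tb) ^ (-|γ|) * ((1 - tb)⁻¹) ^ mn.2)) := by
          refine mul_le_mul_of_nonneg_left (mul_le_mul hA hB (by positivity) (by positivity)) (by positivity)
      _ = |k mn| * u ^ mn.1 * ub ^ mn.2 * ((1 - t) ^ (-|γ|) * (1 - tb) ^ (-|γ|)) := by
          rw [hk, hu, hub, mul_pow, mul_pow]; ring
  have houter : Summable fun mn : ℕ × ℕ => ∑' ij : ℕ × ℕ, ‖F (mn, ij)‖ := by
    refine Summable.of_nonneg_of_le (fun mn => tsum_nonneg fun _ => norm_nonneg _) hinner_le ?_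
    exact (hS.summable_abs hu0 hu1 hub0 hub1).mul_right _
  have nF : Summable fun x : (ℕ × ℕ) × (ℕ × ℕ) => ‖F x‖ :=
    (summable_prod_of_nonneg hFnn).mpr ⟨hinner, houter⟩
  -- the value: fibrewise binomial series, then the `z`-series at the exchanged point
  have hm1 : |moebiusExch y| < 1 := abs_moebiusExch_lt_one hy
  have hm2 : |moebiusExch yb| < 1 := abs_moebiusExch_lt_one hyb
  obtain ⟨hKabs, hKeq⟩ := hS (moebiusExch y) (moebiusExch yb) hm1 hm2
  have hKsum : HasSum (fun p : ℕ × ℕ => k p * (moebiusExch y) ^ p.1 * (moebiusExch yb) ^ p.2)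
      (K (moebiusExch y) (moebiusExch yb)) := by
    rw [hKeq]
    refine (hKabs.of_norm_bounded fun p => ?_).hasSum
    rw [Real.norm_eq_abs, abs_mul, abs_mul, abs_pow, abs_pow]
  have h1y : 0 < 1 - y := by linarith [(abs_lt.mp hy).2]
  have h1yb : 0 < 1 - yb := by linarith [(abs_lt.mp hyb).2]
  have hfib : ∀ mn : ℕ × ℕ, HasSum (fun ij : ℕ × ℕ => F (mn, ij))
      ((1 - y) ^ (-γ) * (1 - yb) ^ (-γ) *
        (k mn * (moebiusExch y) ^ mn.1 * (moebiusExch yb) ^ mn.2)) := by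
    intro mn
    have hA := hasSum_exchW γ mn.1 hy1
    have hB := hasSum_exchW γ mn.2 hyb1
    have nAB : Summable (fun ij : ℕ × ℕ =>
        (exchW γ mn.1 ij.1 * y ^ ij.1) * (exchW γ mn.2 ij.2 * yb ^ ij.2)) := by
      refine Summable.of_norm ?_
      refine ((summable_abs_exchW γ mn.1 hy1).mul_of_nonneg (summable_abs_exchW γ mn.2 hyb1)
        (fun _ => by positivity) (fun _ => by positivity)).congr fun ij => ?_
      simp only [Real.norm_eq_abs, abs_mul, abs_pow]
    have hAB := (hA.mul hB nAB).mul_left (reflArr k mn * y ^ mn.1 * yb ^ mn.2)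
    have e1 : (fun ij : ℕ × ℕ => F (mn, ij)) = fun ij : ℕ × ℕ =>
        reflArr k mn * y ^ mn.1 * yb ^ mn.2 *
          ((exchW γ mn.1 ij.1 * y ^ ij.1) * (exchW γ mn.2 ij.2 * yb ^ ij.2)) := by
      funext ij
      simp only [hF, exchProd]
      ring
    have e2 : (1 - y) ^ (-γ) * (1 - yb) ^ (-γ) *
        (k mn * (moebiusExch y) ^ mn.1 * (moebiusExch yb) ^ mn.2) =
        reflArr k mn * y ^ mn.1 * yb ^ mn.2 *
          ((1 - y) ^ (-((mn.1 : ℝ) + γ)) * (1 - yb) ^ (-((mn.2 : ℝ) + γ))) := by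
      rw [rpow_neg_natCast_add h1y, rpow_neg_natCast_add h1yb, reflArr, moebiusExch_eq_neg_mul_inv,
        moebiusExch_eq_neg_mul_inv, mul_pow, mul_pow, neg_pow y, neg_pow yb, pow_add]
      ring
    rw [e1, e2]
    exact hAB
  have hOuter : HasSum (fun mn : ℕ × ℕ => (1 - y) ^ (-γ) * (1 - yb) ^ (-γ) *
      (k mn * (moebiusExch y) ^ mn.1 * (moebiusExch yb) ^ mn.2)) (exchSeries γ K y yb) := by
    rw [exchSeries]
    exact hKsum.mul_left _
  have hFsum : HasSum F (exchSeries γ K y yb) :=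
    (nF.of_norm.hasSum.prod_fiberwise hfib).unique hOuter ▸ nF.of_norm.hasSum
  -- regroup along `exchShift`
  have hcomp : exchFamily γ k y yb ∘ exchShift = F := by
    funext x
    rw [Function.comp_apply, exchFamily_exchShift]
  have hT'sum : HasSum (exchFamily γ k y yb) (exchSeries γ K y yb) := by
    refine (exchShift_injective.hasSum_iff fun w hw =>
      exchFamily_eq_zero_of_not_mem_range γ k y yb hw).mp ?_
    rw [hcomp]
    exact hFsum
  have hcompAbs : (fun w => ‖exchFamily γ k y yb w‖) ∘ exchShift = fun x => ‖F x‖ := by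
    funext x
    rw [Function.comp_apply, exchFamily_exchShift]
  have hT'abs : HasSum (fun w => ‖exchFamily γ k y yb w‖) (∑' x, ‖F x‖) := by
    refine (exchShift_injective.hasSum_iff (f := fun w => ‖exchFamily γ k y yb w‖)
      fun w hw => by rw [exchFamily_eq_zero_of_not_mem_range γ k y yb hw, norm_zero]).mp ?_
    rw [hcompAbs]
    exact nF.hasSum
  have hmain : HasSum (fun q : ℕ × ℕ => exchCoeff γ k q * y ^ q.1 * yb ^ q.2) (exchSeries γ K y yb) :=
    hT'sum.prod_fiberwise (hasSum_fiber_exchFamily γ k y yb)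
  have habs : Summable (fun q : ℕ × ℕ =>
      ∑ ij ∈ range (q.1 + 1) ×ˢ range (q.2 + 1), ‖exchFamily γ k y yb (q, ij)‖) :=
    (hT'abs.prod_fiberwise (hasSum_fiber_abs_exchFamily γ k y yb)).summable
  exact ⟨hmain, Summable.of_nonneg_of_le (fun q => by positivity) (abs_exchCoeff_mul_le γ k y yb) habs⟩

/-- The exchanged array inherits the symmetry `k_{nm} = k_{mn}`. [folklore] -/
theorem exchCoeff_symm (γ : ℝ) (hsym : ∀ p : ℕ × ℕ, k (p.2, p.1) = k p) (q : ℕ × ℕ) :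
    exchCoeff γ k (q.2, q.1) = exchCoeff γ k q := by
  unfold exchCoeff
  rw [Finset.sum_comm]
  refine Finset.sum_congr rfl fun m _ => Finset.sum_congr rfl fun n _ => ?_
  have h := hsym (m, n)
  simp only [reflArr] at *
  rw [← h, Nat.add_comm n m]
  ring

/-- The boundary row below `ℓ` vanishes. [folklore] -/
theorem exchCoeff_fst_zero_of_lt (γ : ℝ) {ℓ : ℕ} (hlead : HasLeadingPart ℓ k) {M : ℕ} (hM : M < ℓ) :
    exchCoeff γ k (M, 0) = 0 := by
  unfold exchCoeff
  refine Finset.sum_eq_zero fun m hm => Finset.sum_eq_zero fun n hn => ?_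
  rw [Finset.mem_range] at hm hn
  have hn0 : n = 0 := by omega
  subst hn0
  have h0 : k (m, 0) = 0 := hlead.1 m (by omega)
  simp [reflArr, h0]

/-- The boundary row at `ℓ` is `(-1)^ℓ` (the origin of the sign in Dolan–Osborn's (2.23)).
[cite: DolanOsborn2011, §2 eq. (2.23)] -/
theorem exchCoeff_ell_zero (γ : ℝ) {ℓ : ℕ} (hlead : HasLeadingPart ℓ k) :
    exchCoeff γ k (ℓ, 0) = (-1) ^ ℓ := by
  unfold exchCoeff
  rw [Finset.sum_eq_single_of_mem ℓ (by simp) ?_]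
  · rw [Finset.sum_range_one]
    simp [reflArr, hlead.2]
  · intro m hm hml
    rw [Finset.mem_range] at hm
    refine Finset.sum_eq_zero fun n hn => ?_
    rw [Finset.mem_range] at hn
    have hn0 : n = 0 := by omega
    subst hn0
    have h0 : k (m, 0) = 0 := hlead.1 m (by omega)
    simp [reflArr, h0]

/-- The sign-corrected array `(-1)^ℓ · exchCoeff` has the Dolan–Osborn boundary row. [folklore] -/
theorem hasLeadingPart_exchCoeff (γ : ℝ) {ℓ : ℕ} (hlead : HasLeadingPart ℓ k) :
    HasLeadingPart ℓ (fun q => (-1) ^ ℓ * exchCoeff γ k q) := by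
  refine ⟨fun M hM => ?_, ?_⟩
  · show (-1) ^ ℓ * exchCoeff γ k (M, 0) = 0
    rw [exchCoeff_fst_zero_of_lt γ hlead hM, mul_zero]
  show (-1) ^ ℓ * exchCoeff γ k (ℓ, 0) = 1
  rw [exchCoeff_ell_zero γ hlead, ← pow_add, ← two_mul, pow_mul]
  norm_num

/-! ### Rescaling to the unit bidisc -/

/-- The rescaled array `k̂_{MN} = 2^{-(M+N)} exchCoeff_{MN}`. [folklore] -/
noncomputable def exchCoeffHalf (γ : ℝ) (k : ℕ × ℕ → ℝ) (q : ℕ × ℕ) : ℝ :=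
  (1 / 2) ^ (q.1 + q.2) * exchCoeff γ k q

/-- The rescaled function `K̂(τ, τ̄) = exchSeries(τ/2, τ̄/2)`. [folklore] -/
noncomputable def exchSeriesHalf (γ : ℝ) (K : ℝ → ℝ → ℝ) (τ τb : ℝ) : ℝ :=
  exchSeries γ K (τ / 2) (τb / 2)

/-- **The exchanged series rescaled by `τ = 2y` is a double power series on the unit bidisc.** [folklore] -/
theorem isDoublePowerSeriesOn_exchHalf (hS : IsDoublePowerSeriesOn k K) (γ : ℝ) :
    IsDoublePowerSeriesOn (exchCoeffHalf γ k) (exchSeriesHalf γ K) := by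
  intro τ τb hτ hτb
  have hy : |τ / 2| < 1 / 2 := by rw [abs_div, abs_two]; linarith
  have hyb : |τb / 2| < 1 / 2 := by rw [abs_div, abs_two]; linarith
  obtain ⟨hsum, habs⟩ := hasSum_exchCoeff hS γ hy hyb
  refine ⟨habs.congr fun q => ?_, ?_⟩
  · rw [exchCoeffHalf, abs_mul, abs_pow, abs_div, abs_div, abs_two,
      abs_of_pos (by norm_num : (0 : ℝ) < 1 / 2)]
    ring
  · rw [exchSeriesHalf, ← hsum.tsum_eq]
    refine tsum_congr fun q => ?_
    rw [exchCoeffHalf]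
    ring

end Series

/-! ### The exchange transform of the typed block in series form -/

/-- **Series form of the exchange transform of the typed block on `(0,½)²`.** With `α = (Δ-ℓ)/2`,
`b = Δ₃₄/2`, `k₂ = hrMonomialCoeffAB (Δ₁₂/2) (Δ₃₄/2) Δ ℓ` (the array of `g^{-Δ₁₂,Δ₃₄}`) and `K₂` its series:
`exchTransform b (hrBlockAB (-Δ₁₂) Δ₃₄ Δ ℓ) (y,ȳ) = (yȳ)^α · exchSeries (α+b) K₂ (y,ȳ)` for `y, ȳ ∈ (0,½)`
— so on the half-bidisc `S = v^{-b} g^{-Δ₁₂,Δ₃₄}∘exch` is `(yȳ)^α` times the double power series with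
coefficients `exchCoeff (α+b) k₂`. [cite: DolanOsborn2011, §2 eq. (2.23)] -/
theorem exchTransform_hrBlockAB_eq (Δ₁₂ Δ₃₄ Δ : ℝ) (ℓ : ℕ) {y yb : ℝ} (hy0 : 0 < y) (hy1 : y < 1 / 2)
    (hyb0 : 0 < yb) (hyb1 : yb < 1 / 2) :
    exchTransform (Δ₃₄ / 2) (hrBlockAB (-Δ₁₂) Δ₃₄ Δ ℓ) y yb =
      (y * yb) ^ ((Δ - (ℓ : ℝ)) / 2) *
        exchSeries ((Δ - (ℓ : ℝ)) / 2 + Δ₃₄ / 2) (hrSeriesAB (Δ₁₂ / 2) (Δ₃₄ / 2) Δ ℓ) y yb := by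
  have h1y : 0 < 1 - y := by linarith
  have h1yb : 0 < 1 - yb := by linarith
  have hprod : moebiusExch y * moebiusExch yb = (y * yb) * ((1 - y)⁻¹ * (1 - yb)⁻¹) := by
    rw [moebiusExch_eq_neg_mul_inv, moebiusExch_eq_neg_mul_inv]; ring
  rw [exchTransform, exchSeries, hrBlockAB, neg_neg, hprod,
    Real.mul_rpow (mul_nonneg hy0.le hyb0.le) (by positivity),
    Real.mul_rpow (inv_nonneg.mpr h1y.le) (inv_nonneg.mpr h1yb.le), Real.inv_rpow h1y.le,
    Real.inv_rpow h1yb.le, ← Real.rpow_neg h1y.le, ← Real.rpow_neg h1yb.le,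
    show -((Δ - (ℓ : ℝ)) / 2 + Δ₃₄ / 2) = -(Δ₃₄ / 2) + -((Δ - (ℓ : ℝ)) / 2) by ring,
    Real.rpow_add h1y, Real.rpow_add h1yb]
  ring

/-- The `σ–ε` odd pair (`s = Δ_σ - Δ_ε`): `v^{-s/2} g_{⟨εσσε⟩}∘exch = (yȳ)^α · exchSeries (α + s/2) K₂` on `(0,½)²`
with `K₂` the `z`-series of `g_{⟨εσσε⟩} = g^{-s,s}` (`a = b = s/2`). [cite: DolanOsborn2011, §2 eq. (2.23)] -/
theorem exchTransform_hrBlockAB_sigmaEps_eq (Δσ Δε Δ : ℝ) (ℓ : ℕ) {y yb : ℝ} (hy0 : 0 < y)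
    (hy1 : y < 1 / 2) (hyb0 : 0 < yb) (hyb1 : yb < 1 / 2) :
    exchTransform ((Δσ - Δε) / 2) (hrBlockAB (-(Δσ - Δε)) (Δσ - Δε) Δ ℓ) y yb =
      (y * yb) ^ ((Δ - (ℓ : ℝ)) / 2) *
        exchSeries ((Δ - (ℓ : ℝ)) / 2 + (Δσ - Δε) / 2)
          (hrSeriesAB ((Δσ - Δε) / 2) ((Δσ - Δε) / 2) Δ ℓ) y yb :=
  exchTransform_hrBlockAB_eq (Δσ - Δε) (Δσ - Δε) Δ ℓ hy0 hy1 hyb0 hyb1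

end Literature.MathematicalPhysics.QuantumFieldTheory.ConformalBootstrap3D
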